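import Summits.Ventures.PercRepro.GenQTraceProfileA

/-!
# PercRepro — the coloop PAIRS of a level are counted by the corank-2 flats: the row (H1₂) (night-4, gen 24)

The hyperplane-trace block of the profile LP counts the coloops of a level by the hyperplane traces
((H1), `h1_row`: `Σ_m m·#Pc k m = Σ_s (n − s)·SP_{s, n−k−1}` at rank `q − 1`).  Two DISTINCT coloops `x ≠ y` of a
spanning `S` give the rank-`(q − 2)` flat `cl(S ∖ {x, y})` with `S ∖ {x, y}` a spanning `(n − k − 2)`-subset of its
trace and `x, y ∉` the flat; the map `(S, x, y) ↦ (cl(S ∖ {x, y}), (x, y), S ∖ {x, y})` is an INJECTION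
(`S = T ∪ {x, y}`) but not a bijection (`T ∪ {x, y}` need not have rank `q`), hence the row is an inequality:

`Σ_m m(m − 1)·#Pc k m ≤ Σ_s (n − s)(n − s − 1)·SP_{s, n−k−2}` at rank `q − 2`   (`h1_row_pairs`).

At `q = 8` this is the row (H1_6) of the rank-6 block of the `(10, 8)` profile LP — the one row of that block that
was not yet a Lean statement (its twins (A6_j), (H3_6), (H4_6) are `choose_eq_sum_card_rank_subsets`,
`spSum_le_choose_mul_hypTr`, `h4_row` at `r = 6`); with the block the type-7 tail `d ≥ 27` and the cases `(6, 17)`,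
`(6, 21)` are LP-positive (night-4 g23's exact census).  Imports `GenQTraceProfileA`.
-/
namespace PercRepro.Night4

open Finset ThmH SixFour GenQ PerFlat Star

variable {α : Type*} [DecidableEq α] {M : Matroid α} [M.Finite]

/-! ## Two coloops -/

/-- A coloop `y ≠ x` of `S` is a coloop of `S ∖ x` (`coloopsOf_erase_of_mem_coloopsOf`). -/
theorem mem_coloopsOf_erase_of_ne {S : Finset α} {x y : α} (hx : x ∈ coloopsOf M S)
    (hy : y ∈ coloopsOf M S) (hyx : y ≠ x) : y ∈ coloopsOf M (S.erase x) := by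
  rw [coloopsOf_erase_of_mem_coloopsOf hx, Finset.mem_erase]
  exact ⟨hyx, hy⟩

/-- Removing a coloop from a rank-`q` subset of `G` leaves a rank-`(q − 1)` subset of `G`. -/
theorem erase_mem_Rq_of_mem_coloopsOf {G S : Finset α} {q : ℕ} (hG : G ⊆ gr M) (hS : S ∈ Rq M G q)
    {x : α} (hx : x ∈ coloopsOf M S) : S.erase x ∈ Rq M G (q - 1) :=
  mem_Rq.2 ⟨(Finset.erase_subset x S).trans (mem_Rq.1 hS).1, eRk_erase_of_mem_coloopsOf hG hS hx⟩

/-- A coloop `x` of `S` lies outside the closure of any subset of `S ∖ x`. -/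
theorem notMem_closure_of_subset_erase {S T : Finset α} {x : α} (hx : x ∈ coloopsOf M S)
    (hT : T ⊆ S.erase x) : x ∉ M.closure (T : Set α) := fun h =>
  (mem_coloopsOf.1 hx).2 (M.closure_subset_closure (Finset.coe_subset.2 hT) h)

/-! ## The level sums, fiberwise by the coloop count -/

/-- A sum over the level-`k` sets of a function of the coloop count, by the classes `Pc k m`. -/
theorem sum_level_eq_sum_Pc (f : ℕ → ℕ) {G : Finset α} {q k : ℕ} (hG : G ⊆ gr M)
    (hrG : M.eRk (G : Set α) = (q : ℕ∞)) :
    ∑ S ∈ levelSets M G q k, f (mTr M S) = ∑ m ∈ Finset.Icc (mTr M G) q, f m * (Pc M G q k m).card := by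
  classical
  rw [← Finset.sum_fiberwise_of_maps_to (s := levelSets M G q k) (t := Finset.Icc (mTr M G) q)
        (g := fun S : Finset α => mTr M S)]
  · refine Finset.sum_congr rfl (fun m _ => ?_)
    have hfe : (levelSets M G q k).filter (fun S : Finset α => mTr M S = m) = Pc M G q k m := by
      ext S
      rw [Finset.mem_filter, mem_levelSets, mem_Pc]
      tauto
    rw [hfe, Finset.card_eq_sum_ones, Finset.mul_sum, mul_one]
    refine Finset.sum_congr rfl (fun S hS => ?_)
    rw [((mem_Pc.1 hS).2).2]
  · intro S hS
    have hS' := (mem_levelSets.1 hS).1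
    rw [Finset.mem_Icc]
    refine ⟨mTr_le_of_mem_Rq hG hrG hS', ?_⟩
    have hSG : S ⊆ G := (mem_Rq.1 hS').1
    exact mTr_le_of_eRk_eq (hSG.trans hG) (mem_Rq.1 hS').2

/-! ## The injection -/

/-- The ordered coloop pairs of level `k` inject into the triples `(H, (x, y), T)`: `H` a rank-`(q − 2)` flat,
`x ≠ y ∈ G ∖ H`, `T ⊆ H ∩ G` a rank-`(q − 2)` set of `|G| − k − 2` points — by
`(S, (x, y)) ↦ (cl(S ∖ {x, y}), (x, y), S ∖ {x, y})`. -/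
theorem card_coloop_pairs_le_card_corank_two {G : Finset α} {q k : ℕ} (hG : G ⊆ gr M) :
    ((levelSets M G q k).sigma (fun S : Finset α => (coloopsOf M S).offDiag)).card
      ≤ ((flatsQ M (q - 2)).sigma (fun H : Finset α => (G \ H).offDiag ×ˢ
          ((H ∩ G).powersetCard (G.card - k - 2)).filter
            (fun T : Finset α => M.eRk (T : Set α) = ((q - 2 : ℕ) : ℕ∞)))).card := by
  classical
  refine Finset.card_le_card_of_injOn
    (fun p : (Σ _ : Finset α, α × α) => (⟨clF M ((p.1.erase p.2.1).erase p.2.2), (p.2, (p.1.erase p.2.1).erase p.2.2)⟩ :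
      Σ _ : Finset α, (α × α) × Finset α)) ?_ ?_
  · rintro ⟨S, x, y⟩ hp
    rw [Finset.mem_coe, Finset.mem_sigma, Finset.mem_offDiag] at hp
    obtain ⟨hS, hx, hy, hxy⟩ := hp
    have hS' := mem_levelSets.1 hS
    have hSR := mem_Rq.1 hS'.1
    have hx' := mem_coloopsOf.1 hx
    have hy' := mem_coloopsOf.1 hy
    have hSx : S.erase x ∈ Rq M G (q - 1) := erase_mem_Rq_of_mem_coloopsOf hG hS'.1 hx
    have hyx : y ∈ coloopsOf M (S.erase x) := mem_coloopsOf_erase_of_ne hx hy (Ne.symm hxy)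
    have hySx : y ∈ S.erase x := (mem_coloopsOf.1 hyx).1
    have hq2 : q - 1 - 1 = q - 2 := by omega
    have hTsub : (S.erase x).erase y ⊆ S.erase y :=
      Finset.erase_subset_erase y (Finset.erase_subset x S)
    have hTG : (S.erase x).erase y ⊆ G := (Finset.erase_subset y _).trans ((Finset.erase_subset x S).trans hSR.1)
    have hTE : (((S.erase x).erase y : Finset α) : Set α) ⊆ M.E := by
      rw [← coe_gr M]
      exact Finset.coe_subset.2 (hTG.trans hG)
    rw [Finset.mem_coe, Finset.mem_sigma]
    refine ⟨?_, ?_⟩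
    · have h := clF_erase_mem_flatsQ_of_mem_coloopsOf hG hSx hyx
      rwa [hq2] at h
    · rw [Finset.mem_product, Finset.mem_offDiag, Finset.mem_sdiff, Finset.mem_sdiff]
      refine ⟨⟨⟨hSR.1 hx'.1, ?_⟩, ⟨hSR.1 hy'.1, ?_⟩, hxy⟩, ?_⟩
      · rw [mem_clF]
        exact notMem_closure_of_subset_erase hx (Finset.erase_subset y _)
      · rw [mem_clF]
        exact notMem_closure_of_subset_erase hy hTsub
      · rw [Finset.mem_filter, Finset.mem_powersetCard]
        refine ⟨⟨?_, ?_⟩, ?_⟩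
        · intro z hz
          rw [Finset.mem_inter, mem_clF]
          exact ⟨M.subset_closure _ hTE (Finset.mem_coe.2 hz), hTG hz⟩
        · rw [Finset.card_erase_of_mem hySx, Finset.card_erase_of_mem hx'.1]
          have h1 := Finset.card_sdiff_of_subset hSR.1
          have h2 := Finset.card_le_card hSR.1
          omega
        · have h := eRk_erase_of_mem_coloopsOf hG hSx hyx
          rwa [hq2] at h
  · rintro ⟨S, x, y⟩ hp ⟨S', x', y'⟩ hp' heq
    rw [Finset.mem_coe, Finset.mem_sigma, Finset.mem_offDiag] at hp hp'
    obtain ⟨_, hx, hy, hxy⟩ := hp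
    obtain ⟨_, hx2, hy2, _⟩ := hp'
    simp only [Sigma.mk.inj_iff, heq_eq_eq, Prod.mk.injEq] at heq
    obtain ⟨_, ⟨rfl, rfl⟩, hT⟩ := heq
    have hxS : x ∈ S := (mem_coloopsOf.1 hx).1
    have hxS2 : x ∈ S' := (mem_coloopsOf.1 hx2).1
    have hyS : y ∈ S.erase x :=
      (mem_coloopsOf.1 (mem_coloopsOf_erase_of_ne hx hy (Ne.symm hxy))).1
    have hyS2 : y ∈ S'.erase x :=
      (mem_coloopsOf.1 (mem_coloopsOf_erase_of_ne hx2 hy2 (Ne.symm hxy))).1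
    have hSS : S = S' := by
      rw [← Finset.insert_erase hxS, ← Finset.insert_erase hyS, hT, Finset.insert_erase hyS2,
        Finset.insert_erase hxS2]
    subst hSS
    rfl

/-! ## The row -/

/-- **(H1) for coloop pairs, as an LP row**: `Σ_m m(m − 1)·#Pc k m ≤ Σ_s (n − s)(n − s − 1)·SP_{s, n−k−2}` at rank
`q − 2` (`n = |G|`; the sum over all trace sizes `s ≤ n`, the terms with `s < q − 2` or `s < n − k − 2` vanish).
At `q = 8`: the row (H1_6) of the rank-6 block of the `(10, 8)` profile LP. -/
theorem h1_row_pairs {G : Finset α} {q k : ℕ} (hG : G ⊆ gr M) (hrG : M.eRk (G : Set α) = (q : ℕ∞)) :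
    ∑ m ∈ Finset.Icc (mTr M G) q, m * (m - 1) * (Pc M G q k m).card
      ≤ ∑ s ∈ Finset.range (G.card + 1),
          (G.card - s) * (G.card - s - 1) * spSum M G (q - 2) s (G.card - k - 2) := by
  classical
  have hL : ∑ m ∈ Finset.Icc (mTr M G) q, m * (m - 1) * (Pc M G q k m).card
      = ((levelSets M G q k).sigma (fun S : Finset α => (coloopsOf M S).offDiag)).card := by
    rw [← sum_level_eq_sum_Pc (fun m => m * (m - 1)) hG hrG, Finset.card_sigma]
    refine Finset.sum_congr rfl (fun S _ => ?_)
    rw [Finset.offDiag_card, Nat.mul_sub_one]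
    rfl
  have hR : ∑ s ∈ Finset.range (G.card + 1),
          (G.card - s) * (G.card - s - 1) * spSum M G (q - 2) s (G.card - k - 2)
      = ((flatsQ M (q - 2)).sigma (fun H : Finset α => (G \ H).offDiag ×ˢ
          ((H ∩ G).powersetCard (G.card - k - 2)).filter
            (fun T : Finset α => M.eRk (T : Set α) = ((q - 2 : ℕ) : ℕ∞)))).card := by
    rw [← sum_flatsQ_spF_eq_sum_spSum G (q - 2) (G.card - k - 2) (fun s => (G.card - s) * (G.card - s - 1)),
      Finset.card_sigma]
    refine Finset.sum_congr rfl (fun H _ => ?_)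
    rw [Finset.card_product, Finset.offDiag_card, card_sdiff_eq_card_sub_card_inter, Nat.mul_sub_one]
    rfl
  rw [hL, hR]
  exact card_coloop_pairs_le_card_corank_two hG

end PercRepro.Night4
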